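import Mathlib
import Summits.NavierStokesRegularity.NavierStokesRegularity.Theorems.ThreadingFluxHorizonTowerDefs
import Summits.NavierStokesRegularity.NavierStokesRegularity.Theorems.ThreadingFluxHorizonTowerL2DegreeTwo
import Summits.NavierStokesRegularity.NavierStokesRegularity.Theorems.ThreadingFluxHorizonTowerL2Quadrupole
import Summits.NavierStokesRegularity.NavierStokesRegularity.Theorems.ThreadingFluxHorizonTowerZonalBridge
import Summits.NavierStokesRegularity.NavierStokesRegularity.Theorems.ThreadingFluxHorizonTowerZonalIsotropicAxis
import Summits.NavierStokesRegularity.NavierStokesRegularity.Theorems.ThreadingFluxLoopLawQuadraticBracketRigidity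
import HarnessLib

/-!
# Crux `PoloidalLiouville` (stmt-NavierStokesRegularity-1222, W1/W2), crux idea «linear-loop-law» (ns-idea-15 g3):
# SAME-DEGREE BRACKET RIGIDITY AT DEGREE 2 — `SameDegreeBracketRigidityAt 2` of
# `Cruxes/PoloidalLiouville/LoopLawSketch.lean`, PROVED (body VERBATIM)

Support file (`--supports stmt-NavierStokesRegularity-1222`, helper).  Experiment cell `ns-wall-extremal`, width hand
ns-wall-eng-4 g3.  0 kit.  The statement is the sketch's `SameDegreeBracketRigidityAt 2` with the sketch-local
`IsSolidHarmonic l P = P.IsHomogeneous l ∧ ∀ y, Δ (peval P) y = 0`, `peval P = fun y => MvPolynomial.eval (fun i => y i) P`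
and `loopBracket f g y = ⟪y, ∇f y × ∇g y⟫` unfolded: two degree-2 solid harmonics (as polynomials in three variables)
with identically vanishing loop bracket are proportional.  It is the input `SameDegreeBracketRigidityAt 2` of the card's
priced rungs `PureDegreeShapeRigidityOfBR` / `PureDegreeDatumRungOfBR` («unconditional for l ≤ 2 once
`QuadraticBracketRigidity` lands»).

PROOF.  A degree-2 homogeneous polynomial function is a quadratic form `⟪y, Qy⟫` of a symmetric `Q` (eng-4 g2
`exists_quadForm_of_homogeneous_two`), traceless iff harmonic (`laplacian_quadForm_eq_trace`), with gradient `2Qy`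
(`gradient_quadForm`); so the bracket condition is `4⟪y, Q_A y × Q_B y⟫ = 0` and K-alg₂ (`LoopLaw.quadraticBracketRigidity`,
this seat) gives `Q_B = c Q_A`, i.e. `peval B = c · peval A`, i.e. `B = c • A` (polynomials over `ℝ` are determined by their
values, eng-5 g4 `Zonal.eq_zero_of_evalE_eq_zero`).

HONEST FRAME: finite-dimensional algebra; rungs untouched; 1222 / 27585 and NS regularity stay OPEN.
-/

-- the summit and its single problem share the name (D-0017 nested layout)
set_option linter.dupNamespace false

noncomputable section

namespace Summit.NavierStokesRegularity.NavierStokesRegularity.Theorems.PoloidalLiouville.LoopLaw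

open Set Function
open scoped RealInnerProductSpace
open Literature.Analysis.FluidPDE
open Summit.NavierStokesRegularity.NavierStokesRegularity.Theorems.PoloidalLiouville.HorizonTower

/-- **SAME-DEGREE BRACKET RIGIDITY AT `l = 2`** (body of the sketch's `SameDegreeBracketRigidityAt 2`, VERBATIM with
`IsSolidHarmonic`, `peval`, `loopBracket` unfolded). -/
theorem sameDegreeBracketRigidityAt_two :
    ∀ (A B : MvPolynomial (Fin 3) ℝ),
      (A.IsHomogeneous 2 ∧ ∀ y : E3, Laplacian.laplacian (fun y : E3 => MvPolynomial.eval (fun i => y i) A) y = 0) →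
      (B.IsHomogeneous 2 ∧ ∀ y : E3, Laplacian.laplacian (fun y : E3 => MvPolynomial.eval (fun i => y i) B) y = 0) →
      A ≠ 0 →
      (∀ y : E3, inner ℝ y (cross (gradient (fun y : E3 => MvPolynomial.eval (fun i => y i) A) y)
        (gradient (fun y : E3 => MvPolynomial.eval (fun i => y i) B) y)) = 0) →
      ∃ c : ℝ, B = c • A := by
  intro A B hA hB hA0 hbr
  obtain ⟨hAh, hAΔ⟩ := hA
  obtain ⟨hBh, hBΔ⟩ := hB
  -- polynomial functions as quadratic forms
  have hquad : ∀ P : MvPolynomial (Fin 3) ℝ, P.IsHomogeneous 2 →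
      (∀ y : E3, Laplacian.laplacian (fun y : E3 => MvPolynomial.eval (fun i => y i) P) y = 0) →
      ∃ Q : E3 →L[ℝ] E3, IsShapeTensor Q ∧ (∀ y : E3, Zonal.evalE P y = ⟪y, Q y⟫) ∧
        ∀ y : E3, gradient (Zonal.evalE P) y = (2 : ℝ) • Q y := by
    intro P hP hPΔ
    have hsm : ContDiff ℝ 2 (Zonal.evalE P) := (Zonal.contDiff_evalE P).of_le (by norm_cast)
    have hhom : ∀ (c : ℝ) (y : E3), Zonal.evalE P (c • y) = c ^ 2 * Zonal.evalE P y := by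
      intro c y
      have h := Zonal.eval_smul_of_isHomogeneous hP c (fun i => y i)
      simpa [Zonal.evalE] using h
    obtain ⟨Q, hQs, hQ⟩ := exists_quadForm_of_homogeneous_two hsm hhom
    have hfun : Zonal.evalE P = fun y : E3 => ⟪y, Q y⟫ := funext hQ
    refine ⟨Q, ⟨hQs, ?_⟩, hQ, fun y => ?_⟩
    · have h := hPΔ 0
      change Laplacian.laplacian (Zonal.evalE P) 0 = 0 at h
      rw [hfun, laplacian_quadForm_eq_trace] at h
      linarith
    · rw [hfun, gradient_quadForm Q hQs]
  obtain ⟨QA, hQA, hAQ, hgA⟩ := hquad A hAh hAΔ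
  obtain ⟨QB, hQB, hBQ, hgB⟩ := hquad B hBh hBΔ
  -- the bracket condition for the operators
  have hdet : ∀ y : E3, ⟪y, cross (QA y) (QB y)⟫ = 0 := by
    intro y
    have h := hbr y
    change ⟪y, cross (gradient (Zonal.evalE A) y) (gradient (Zonal.evalE B) y)⟫ = 0 at h
    have e : cross ((2 : ℝ) • QA y) ((2 : ℝ) • QB y) = (2 : ℝ) • ((2 : ℝ) • cross (QA y) (QB y)) := by
      rw [← crossCLM_apply, ← crossCLM_apply, map_smul, map_smul]; rfl
    rw [hgA, hgB, e, inner_smul_right, inner_smul_right] at h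
    nlinarith
  -- `Q_A ≠ 0`
  have hQA0 : QA ≠ 0 := by
    intro h0
    apply hA0
    apply Zonal.eq_zero_of_evalE_eq_zero
    intro y
    rw [hAQ, h0]
    simp
  obtain ⟨c, hc⟩ := quadraticBracketRigidity QA QB hQA hQB hQA0 hdet
  refine ⟨c, ?_⟩
  -- `B − c • A` vanishes identically
  have hzero : B - c • A = 0 := by
    apply Zonal.eq_zero_of_evalE_eq_zero
    intro y
    have hBy : Zonal.evalE B y = c * Zonal.evalE A y := by
      rw [hBQ, hAQ, hc]
      show ⟪y, c • QA y⟫ = c * ⟪y, QA y⟫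
      rw [inner_smul_right]
    simp only [Zonal.evalE, map_sub, MvPolynomial.smul_eval] at hBy ⊢
    linarith
  exact sub_eq_zero.mp hzero

end Summit.NavierStokesRegularity.NavierStokesRegularity.Theorems.PoloidalLiouville.LoopLaw

end
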